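import Mathlib
import Summits.ValiantsHypothesis.ValiantsHypothesis.Theorems.GrenetZeonDualUnipotentThreeHalvesRadicalCoarseningFineFlag
import Summits.ValiantsHypothesis.ValiantsHypothesis.Theorems.DualUnipotentThreeHalves.Negative.FlagCheapOfTriangularisable

/-!
# `GrenetZeon.DualUnipotentThreeHalves` (stmt-ValiantsHypothesis-24318) — line `radical_split`: stub R1
# `stub_radicalCoarsening` («RADICAL COARSENING») PROVED — `radicalCoarsening` is the registered statement, unfolded

HONEST FRAMING.  Helper file (`--supports stmt-ValiantsHypothesis-24318 --as helper`; val-lit port pool, seat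
val-port-3 g0; desk g12 RULING #271 (a′) / #272 (d); line owner val-idea-9 g3, val-lit bus l.7792).  BRICK 3 on top of
BRICKS 1, 2a–2c (`…RadicalCoarseningTrace` / `…LoewyFlag` / `…FineFlag`): `radicalCoarsening` has EXACTLY the text of
the line's `RadicalCoarsening` (`Cruxes/DualUnipotentThreeHalves/Lines/radical_split.lean` §1b) with the line-local
definitions `RadOrth` / `pencilAlg` / `linPart` / `FlagCheap` / `FlagAdaptedUpTo` / `flagDeg` / `FlagAdapted` / `lineSubst`
written out (checked in scratch against verbatim copies: `example : RadicalCoarsening := radicalCoarsening` elaborates),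
so the crux-write holder can wire `stub_radicalCoarsening := …RadicalCoarsening.radicalCoarsening`.  R1 is ONE stub of
a LINE whose residual `stub_heavyTopLaw` (R2, LAW tier) and `stub_gms` (S2, typed-open Literature fact GMS 2023
Cor. 1.6) remain OPEN: nothing here bears on the rung `…Theses.GrenetZeon.DualUnipotentThreeHalves`, on 24318 / 8062,
or on `VP ≠ VNP` (NOT proved).  No definitions, no named facts.

PROOF (the card's §2, with a CLOSED-FORM coarsening).  BRICK 1: `RadOrth` puts every linear part `N(v) − N(0)`,
`v ∈ K`, in the Jacobson radical `J` of the pencil algebra `𝒜(N)`, and `J^L = ⊥` (Artinian).  BRICK 2: the Loewy chain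
`F_t = J^t·ℂ^m` (antitone, `F_0 = ⊤`, `F_L = ⊥`, `𝒜`-stable, `J` climbs) and a basis `b` adapted to it with fine levels
`lvl` (`exists_adapted_basis`: `b i ∈ F (lvl i)`, coordinates of `F t` supported on `{lvl ≥ t}`, `#{lvl ≥ t} = dim F t`).
COARSENING: `λ := ⌊√n⌋` (≥ 1: the hypothesis forces `n ≥ 1`), COARSE level `⌊(m − dim F_{lvl i})/λ⌋ ≤ (m−1)/λ`.  The
constant part `N(x) ∈ 𝒜` preserves the chain, so it never lowers fine or coarse levels; the `s`-part raises the fine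
level, hence never lowers the coarse one, and raises it STRICTLY unless `(i, j)` is a CROSS PAIR (equal coarse levels,
`lvl j < lvl i`).  The directions `K' ⊆ K` killing the `b`-coordinates of the `s`-part on all cross pairs form the kernel of
a linear map to `ℂ^S`, so `dim K' ≥ dim K − #S`; each `i` has `< λ` cross partners (they lie in fine levels `[lvl j₀, lvl i)`
whose count `dim F_{lvl j₀} − dim F_{lvl i}` is `< λ` because the two cumulative codimensions lie in one window of
length `λ`), so `#S ≤ λ·m`.  `flagAdaptedUpTo_of_levels` turns the level conditions into the coordinate statement
(`p = (m−1)/λ + 1` levels, `r = a = 0`, budget `k = (m−1)/λ`), and `(k+1)·n + λ·m ≤ mλ + 2m + n + λm ≤ 16m⌊√n⌋ + 16n < dim K`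
(using `n ≤ λ² + 2λ`).  [the line's card §2; folklore linear algebra]
-/

-- `Summit.ValiantsHypothesis.ValiantsHypothesis.…` is the tree's mandated single-conjunct layout (Sub = Summit).
set_option linter.dupNamespace false

noncomputable section

namespace Summit.ValiantsHypothesis.ValiantsHypothesis.Theorems.GrenetZeon.RadicalCoarsening

open Matrix MvPolynomial
open scoped BigOperators

section AdaptedBasisFin

variable {m : ℕ}

/-- **Adapted basis, `Fin m`-indexed, exposed.**  For an antitone chain `F 0 = ⊤ ⊇ ⋯ ⊇ F L = ⊥` of subspaces of `ℂ^m`: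
a basis `b` of `ℂ^m` and fine levels `lvl` with `b i ∈ F (lvl i)`, `lvl i < L`, coordinates of any `w ∈ F t`
supported on `{i | t ≤ lvl i}`, and `#{i | t ≤ lvl i} = dim F t`. [folklore] -/
theorem exists_adapted_basis (F : ℕ → Submodule ℂ (Fin m → ℂ)) (hanti : Antitone F) (hF0 : F 0 = ⊤) {L : ℕ}
    (hFL : F L = ⊥) :
    ∃ (b : Module.Basis (Fin m) ℂ (Fin m → ℂ)) (lvl : Fin m → ℕ),
      (∀ i, b i ∈ F (lvl i)) ∧ (∀ i, lvl i < L) ∧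
      (∀ (t : ℕ) (w : Fin m → ℂ), w ∈ F t → ∀ i, b.repr w i ≠ 0 → t ≤ lvl i) ∧
      (∀ t, (Finset.univ.filter (fun i => t ≤ lvl i)).card = Module.finrank ℂ (F t)) := by
  classical
  obtain ⟨B, lvl, hli, hsp, hmemF, hlvlL, hspan⟩ := exists_adapted_set F hanti hF0 L hFL
  have hli' : LinearIndependent ℂ (fun u : B => (u : Fin m → ℂ)) := hli.linearIndependent
  have hsp' : ⊤ ≤ Submodule.span ℂ (Set.range fun u : B => (u : Fin m → ℂ)) := by
    rw [Subtype.range_coe, hsp]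
  let bB : Module.Basis B ℂ (Fin m → ℂ) := Module.Basis.mk hli' hsp'
  haveI : Fintype B := hli'.setFinite.fintype
  have hcard : Fintype.card B = m := by
    have h := Module.finrank_eq_card_basis bB
    rw [Module.finrank_fin_fun] at h
    exact h.symm
  let e : B ≃ Fin m := Fintype.equivFinOfCardEq hcard
  let b : Module.Basis (Fin m) ℂ (Fin m → ℂ) := bB.reindex e
  have hb : ∀ i, b i = ((e.symm i : B) : Fin m → ℂ) := fun i => by
    show (bB.reindex e) i = _
    rw [Module.Basis.reindex_apply, Module.Basis.mk_apply]
  have hbmem : ∀ i, b i ∈ B := fun i => by rw [hb]; exact (e.symm i).2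
  have key : ∀ (t : ℕ) (w : Fin m → ℂ), w ∈ F t → ∀ i, b.repr w i ≠ 0 → t ≤ lvl (b i) := by
    intro t w hw i hi
    have hw' : w ∈ Submodule.span ℂ (b '' {i | t ≤ lvl (b i)}) := by
      refine Submodule.span_mono ?_ (hspan t hw)
      rintro u ⟨huB, hut⟩
      refine ⟨e ⟨u, huB⟩, ?_, ?_⟩
      · show t ≤ lvl (b (e ⟨u, huB⟩))
        rw [hb, Equiv.symm_apply_apply]
        exact hut
      · rw [hb, Equiv.symm_apply_apply]
    have hsub := b.repr_support_subset_of_mem_span _ hw'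
    exact hsub (Finsupp.mem_support_iff.2 hi)
  have hlt : ∀ i, lvl (b i) < L := by
    intro i
    rcases (hlvlL (b i) (hbmem i)).lt_or_eq with hlt | heq
    · exact hlt
    · exfalso
      have hmem := hmemF (b i) (hbmem i)
      rw [heq, hFL, Submodule.mem_bot] at hmem
      exact b.ne_zero i hmem
  refine ⟨b, fun i => lvl (b i), fun i => hmemF (b i) (hbmem i), hlt, key, fun t => ?_⟩
  -- the vectors of level `≥ t` form a basis of `F t`
  let T : Set (Fin m) := {i | t ≤ lvl (b i)}
  have hspanT : Submodule.span ℂ (Set.range fun i : T => b i) = F t := by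
    apply le_antisymm
    · rw [Submodule.span_le]
      rintro _ ⟨⟨i, hi⟩, rfl⟩
      exact hanti hi (hmemF (b i) (hbmem i))
    · intro w hw
      have hsupp : ∀ i, b.repr w i ≠ 0 → i ∈ T := fun i hi => key t w hw i hi
      rw [← b.linearCombination_repr w, Finsupp.linearCombination_apply, Finsupp.sum]
      refine Submodule.sum_mem _ fun i hi => ?_
      have hiT : i ∈ T := hsupp i (Finsupp.mem_support_iff.1 hi)
      exact Submodule.smul_mem _ _ (Submodule.subset_span ⟨⟨i, hiT⟩, rfl⟩)
    
  have hliT : LinearIndependent ℂ (fun i : T => b i) := b.linearIndependent.comp _ Subtype.coe_injective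
  have h1 := finrank_span_eq_card hliT
  rw [hspanT] at h1
  rw [h1, ← Set.toFinset_card]
  congr 1
  ext i
  simp [T]

end AdaptedBasisFin

section Levels

variable {m : ℕ}

/-- **`FlagAdaptedUpTo` from LEVEL CONDITIONS in a basis** (unfolded `FlagAdaptedUpTo m (p-1) n M`): if in the basis `b`
the constant part of `M` never lowers the level `ℓ` (`[M₀ b_j]_i ≠ 0 ⇒ ℓ j ≤ ℓ i`), the `s`-part raises it
(`[M₁ b_j]_i ≠ 0 ⇒ ℓ j + 1 ≤ ℓ i`), levels are `< p` and there is no `s²`, then conjugating by the coordinate matrix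
of `b` exhibits `M` as adapted with `p` levels, drop `0`, weight `0`. [folklore] -/
theorem flagAdaptedUpTo_of_levels (b : Module.Basis (Fin m) ℂ (Fin m → ℂ)) (ℓ : Fin m → ℕ) {p : ℕ}
    (hp : ∀ i, ℓ i < p) (M : Matrix (Fin m) (Fin m) (MvPolynomial (Fin 1) ℂ))
    (h0 : ∀ i j, b.repr ((M.map (coeff 0)).mulVec (b j)) i ≠ 0 → ℓ j ≤ ℓ i)
    (h1 : ∀ i j, b.repr ((M.map (coeff (Finsupp.single 0 1))).mulVec (b j)) i ≠ 0 → ℓ j + 1 ≤ ℓ i)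
    (h2 : ∀ d : Fin 1 →₀ ℕ, 2 ≤ d 0 → ∀ i j, coeff d (M i j) = 0) (n : ℕ) :
    ∃ (g : (Matrix (Fin m) (Fin m) ℂ)ˣ) (lvl : Fin m → ℕ) (p' r a : ℕ),
      (∀ i, lvl i < p') ∧ (p' - 1 + r * (n - 1)) / (a + 1) ≤ p - 1 ∧
      ∀ (i j : Fin m) (d : Fin 1 →₀ ℕ),
        coeff d (((g : Matrix (Fin m) (Fin m) ℂ).map C * M * (↑g⁻¹ : Matrix (Fin m) (Fin m) ℂ).map C :
            Matrix (Fin m) (Fin m) (MvPolynomial (Fin 1) ℂ)) i j) ≠ 0 →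
          (a + 1) * d 0 + lvl j ≤ lvl i + r := by
  classical
  let Q : Matrix (Fin m) (Fin m) ℂ := LinearMap.toMatrix' (b.equivFun : (Fin m → ℂ) →ₗ[ℂ] (Fin m → ℂ))
  let P : Matrix (Fin m) (Fin m) ℂ := LinearMap.toMatrix' (b.equivFun.symm : (Fin m → ℂ) →ₗ[ℂ] (Fin m → ℂ))
  let g : (Matrix (Fin m) (Fin m) ℂ)ˣ :=
    ⟨Q, P, toMatrix'_equivFun_mul_symm b, toMatrix'_symm_mul_equivFun b⟩
  refine ⟨g, ℓ, p, 0, 0, hp, by simp, ?_⟩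
  intro i j d hd
  show (0 + 1) * d 0 + ℓ j ≤ ℓ i + 0
  have hg : ((g : (Matrix (Fin m) (Fin m) ℂ)ˣ) : Matrix (Fin m) (Fin m) ℂ) = Q := rfl
  have hg' : ((g⁻¹ : (Matrix (Fin m) (Fin m) ℂ)ˣ) : Matrix (Fin m) (Fin m) ℂ) = P := rfl
  rw [hg, hg', coeff_conj_apply] at hd
  have hdd : d = Finsupp.single 0 (d 0) := by
    refine Finsupp.ext fun t => ?_
    have ht : t = 0 := Subsingleton.elim t 0
    subst ht
    rw [Finsupp.single_eq_same]
  rcases Nat.lt_or_ge (d 0) 2 with hlt | hge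
  · rcases (show d 0 = 0 ∨ d 0 = 1 by omega) with h | h
    · have hd0 : d = 0 := by rw [hdd, h, Finsupp.single_zero]
      rw [hd0, conj_entry_eq_repr] at hd
      have := h0 i j hd
      rw [h]
      omega
    · have hd1 : d = Finsupp.single 0 1 := by rw [hdd, h]
      rw [hd1, conj_entry_eq_repr] at hd
      have := h1 i j hd
      rw [h]
      omega
  · exfalso
    apply hd
    have hz : M.map (coeff d) = 0 := by
      ext k l
      rw [Matrix.map_apply, Matrix.zero_apply]
      exact h2 d hge k l
    rw [hz, Matrix.mul_zero, Matrix.zero_mul, Matrix.zero_apply]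

end Levels

section Main

open Summit.ValiantsHypothesis.ValiantsHypothesis.Cruxes.TwoDimCoefficients.DimTwoCases (AffMat IsAffine)

variable {n m : ℕ}

/-- The linear part `v ↦ N(v) − N(0)` of an affine pencil is a LINEAR map. [folklore] -/
theorem exists_linPart_linearMap (N : AffMat n m) (hN : IsAffine N) :
    ∃ Λ : (Fin n × Fin n → ℂ) →ₗ[ℂ] Matrix (Fin m) (Fin m) ℂ,
      ∀ v, Λ v = N.map (MvPolynomial.eval v) - N.map (MvPolynomial.eval 0) := by
  refine ⟨{ toFun := fun v => N.map (MvPolynomial.eval v) - N.map (MvPolynomial.eval 0),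
             map_add' := ?_,
             map_smul' := ?_ }, fun v => rfl⟩
  · intro v w
    ext i j
    simp only [Matrix.sub_apply, Matrix.map_apply, Matrix.add_apply]
    rw [eval_sub_eval_zero_of_totalDegree_le_one _ (hN i j), eval_sub_eval_zero_of_totalDegree_le_one _ (hN i j),
      eval_sub_eval_zero_of_totalDegree_le_one _ (hN i j), ← Finset.sum_add_distrib]
    refine Finset.sum_congr rfl fun c _ => ?_
    rw [Pi.add_apply, add_mul]
  · intro a v
    ext i j
    simp only [Matrix.sub_apply, Matrix.map_apply, Matrix.smul_apply, RingHom.id_apply, smul_eq_mul]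
    rw [eval_sub_eval_zero_of_totalDegree_le_one _ (hN i j), eval_sub_eval_zero_of_totalDegree_le_one _ (hN i j),
      Finset.mul_sum]
    refine Finset.sum_congr rfl fun c _ => ?_
    rw [Pi.smul_apply, smul_eq_mul, mul_assoc]

/-- **R1 — RADICAL COARSENING** (the line's `RadicalCoarsening`, UNFOLDED token-for-token: `RadOrth` / `pencilAlg` /
`linPart` / `FlagCheap` / `FlagAdaptedUpTo` / `flagDeg` / `FlagAdapted` / `lineSubst` written out).  An affine pencil with a
direction space `K` trace-orthogonal to the pencil algebra and `16·m·⌊√n⌋ + 16·n < dim K` is flag-cheap.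
Proof: BRICK 1 (the linear parts lie in the nilpotent Jacobson radical), BRICK 2 (Loewy flag + adapted basis), the
threshold coarsening of the module docstring (levels `⌊(m − dim F_{lvl})/λ⌋`, cross pairs killed by `≤ λ·m` linear
conditions on `K`), and `flagAdaptedUpTo_of_levels`; the window arithmetic is val-neg-2's landed
`…DualUnipotentThreeHalvesNegative.FlagCost.sub_lt_of_div_eq_div`. [the line's card §2; folklore] -/
theorem radicalCoarsening (n m : ℕ) (N : AffMat n m) (hN : IsAffine N) (K : Submodule ℂ (Fin n × Fin n → ℂ))
    (hK : ∀ v ∈ K, ∀ b ∈ Algebra.adjoin ℂ (Set.range fun x : Fin n × Fin n → ℂ => N.map (MvPolynomial.eval x)),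
      Matrix.trace ((N.map (MvPolynomial.eval v) - N.map (MvPolynomial.eval 0)) * b) = 0)
    (hdim : 16 * m * Nat.sqrt n + 16 * n < Module.finrank ℂ K) :
    ∃ (K' : Submodule ℂ (Fin n × Fin n → ℂ)) (k : ℕ),
      (∀ x v : Fin n × Fin n → ℂ, v ∈ K' →
        ∃ (g : (Matrix (Fin m) (Fin m) ℂ)ˣ) (lvl : Fin m → ℕ) (p r a : ℕ),
          (∀ i, lvl i < p) ∧ (p - 1 + r * (n - 1)) / (a + 1) ≤ k ∧
          ∀ (i j : Fin m) (d : Fin 1 →₀ ℕ),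
            coeff d (((g : Matrix (Fin m) (Fin m) ℂ).map C *
                N.map (MvPolynomial.aeval fun c =>
                  (C (x c) + ∑ t : Fin 1, C (v c) * X t : MvPolynomial (Fin 1) ℂ)) *
                (↑g⁻¹ : Matrix (Fin m) (Fin m) ℂ).map C : Matrix (Fin m) (Fin m) (MvPolynomial (Fin 1) ℂ)) i j) ≠ 0 →
            (a + 1) * d 0 + lvl j ≤ lvl i + r) ∧
      (k + 1) * n < Module.finrank ℂ K' := by
  classical
  -- λ = ⌊√n⌋ ≥ 1 (the hypothesis forces `n ≥ 1` since `dim K ≤ n²`)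
  have hKle : Module.finrank ℂ K ≤ n * n := by
    have := Submodule.finrank_le K
    rwa [Module.finrank_fintype_fun_eq_card, Fintype.card_prod, Fintype.card_fin] at this
  have hn : 1 ≤ n := by
    rcases Nat.eq_zero_or_pos n with h | h
    · exfalso
      subst h
      have h0 : Module.finrank ℂ K = 0 := by omega
      rw [h0] at hdim
      exact Nat.not_lt_zero _ hdim
    · exact h
  set lam := Nat.sqrt n with hlam
  have hlam1 : 1 ≤ lam := by rw [hlam]; exact Nat.le_sqrt.2 (by simpa using hn)
  have hnlam : n ≤ lam * lam + 2 * lam := by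
    have := Nat.lt_succ_sqrt n
    rw [← hlam] at this
    nlinarith
  -- BRICK 1: the Jacobson radical of the pencil algebra is nilpotent and contains the linear parts
  set 𝒜 := Algebra.adjoin ℂ (Set.range fun x : Fin n × Fin n → ℂ => N.map (MvPolynomial.eval x)) with h𝒜
  obtain ⟨L, hJ⟩ := exists_jacobson_pow_eq_bot 𝒜
  -- BRICK 2: Loewy flag and adapted basis
  obtain ⟨F, hanti, hF0, hFL, hstab, hclimb⟩ := exists_loewy_flag 𝒜 (Ideal.jacobson (⊥ : Ideal 𝒜)) hJ
  obtain ⟨b, lvl, hbF, hlt, key, hcount⟩ := exists_adapted_basis F hanti hF0 hFL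
  -- the linear part as a linear map
  obtain ⟨Λ, hΛ⟩ := exists_linPart_linearMap N hN
  have hΛmem : ∀ v, Λ v ∈ 𝒜 := fun v => by rw [hΛ]; exact linPart_mem_pencilAdjoin N v
  have hΛJ : ∀ v ∈ K, (⟨Λ v, hΛmem v⟩ : 𝒜) ∈ Ideal.jacobson (⊥ : Ideal 𝒜) := by
    intro v hv
    have := linPart_mem_jacobson_of_radOrth N K hK hv
    convert this using 2
    exact hΛ v
  -- fine bookkeeping: ranks along the chain
  have hfr_le : ∀ t, Module.finrank ℂ (F t) ≤ m := fun t => by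
    have := Submodule.finrank_le (F t)
    rwa [Module.finrank_fin_fun] at this
  have hfr_mono : ∀ {s t : ℕ}, s ≤ t → Module.finrank ℂ (F t) ≤ Module.finrank ℂ (F s) :=
    fun hst => Submodule.finrank_mono (hanti hst)
  have hfr_pos : ∀ i, 1 ≤ Module.finrank ℂ (F (lvl i)) := by
    intro i
    by_contra h0
    have h0' : Module.finrank ℂ (F (lvl i)) = 0 := by omega
    have : F (lvl i) = ⊥ := Submodule.finrank_eq_zero.1 h0'
    have hmem := hbF i
    rw [this, Submodule.mem_bot] at hmem
    exact b.ne_zero i hmem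
  -- coarse levels
  let clvl : Fin m → ℕ := fun i => (m - Module.finrank ℂ (F (lvl i))) / lam
  have hclvl_mono : ∀ {i j : Fin m}, lvl j ≤ lvl i → clvl j ≤ clvl i := by
    intro i j hij
    exact Nat.div_le_div_right (Nat.sub_le_sub_left (hfr_mono hij) m)
  have hclvl_lt : ∀ i, clvl i < (m - 1) / lam + 1 := by
    intro i
    have : clvl i ≤ (m - 1) / lam := Nat.div_le_div_right (by have := hfr_pos i; omega)
    omega
  -- the cross-pair functionals and the direction space
  let φ : Fin m → Fin m → (Fin n × Fin n → ℂ) →ₗ[ℂ] ℂ := fun i j =>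
    (Finsupp.lapply i) ∘ₗ (b.repr : (Fin m → ℂ) →ₗ[ℂ] (Fin m →₀ ℂ)) ∘ₗ
      (LinearMap.applyₗ (b j)) ∘ₗ (Matrix.toLin' : Matrix (Fin m) (Fin m) ℂ ≃ₗ[ℂ] _).toLinearMap ∘ₗ Λ
  have hφ : ∀ i j v, φ i j v = b.repr ((Λ v).mulVec (b j)) i := by
    intro i j v
    simp [φ, Matrix.toLin'_apply]
  let S : Finset (Fin m × Fin m) :=
    Finset.univ.filter (fun ij => clvl ij.1 = clvl ij.2 ∧ lvl ij.2 < lvl ij.1)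
  let Φ : (Fin n × Fin n → ℂ) →ₗ[ℂ] (S → ℂ) := LinearMap.pi (fun s : S => φ s.1.1 s.1.2)
  let Ψ : K →ₗ[ℂ] (S → ℂ) := Φ ∘ₗ K.subtype
  let K' : Submodule ℂ (Fin n × Fin n → ℂ) := Submodule.map K.subtype (LinearMap.ker Ψ)
  have hK'mem : ∀ v, v ∈ K' → v ∈ K ∧ ∀ ij ∈ S, φ ij.1 ij.2 v = 0 := by
    intro v hv
    obtain ⟨u, hu, rfl⟩ := Submodule.mem_map.1 hv
    refine ⟨u.2, fun ij hij => ?_⟩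
    have hu' : Ψ u = 0 := LinearMap.mem_ker.1 hu
    have := congrFun hu' ⟨ij, hij⟩
    simpa [Ψ, Φ] using this
  -- counting: dim K' ≥ dim K − #S and #S ≤ λ·m
  have hK'dim : Module.finrank ℂ K ≤ Module.finrank ℂ K' + S.card := by
    have h1 : Module.finrank ℂ K' = Module.finrank ℂ (LinearMap.ker Ψ) :=
      Submodule.finrank_map_subtype_eq K (LinearMap.ker Ψ)
    have h2 := LinearMap.finrank_range_add_finrank_ker Ψ
    have h3 : Module.finrank ℂ (LinearMap.range Ψ) ≤ S.card := by
      have := Submodule.finrank_le (LinearMap.range Ψ)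
      rwa [Module.finrank_fintype_fun_eq_card, Fintype.card_coe] at this
    omega
  have hScard : S.card ≤ lam * m := by
    -- each `i` has fewer than `λ` cross partners
    have hfib : ∀ i : Fin m, (Finset.univ.filter (fun j => clvl i = clvl j ∧ lvl j < lvl i)).card ≤ lam := by
      intro i
      set T := Finset.univ.filter (fun j => clvl i = clvl j ∧ lvl j < lvl i) with hT
      rcases T.eq_empty_or_nonempty with hT0 | hTne
      · rw [hT0]; simp
      · -- the smallest fine level in the fibre
        obtain ⟨j₀, hj₀, hmin⟩ := T.exists_min_image (fun j => lvl j) hTne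
        have hj₀' := (Finset.mem_filter.1 hj₀).2
        have hsub : T ⊆ Finset.univ.filter (fun j => lvl j₀ ≤ lvl j) \
            Finset.univ.filter (fun j => lvl i ≤ lvl j) := by
          intro j hj
          have hj' := (Finset.mem_filter.1 hj).2
          rw [Finset.mem_sdiff, Finset.mem_filter, Finset.mem_filter]
          exact ⟨⟨Finset.mem_univ _, hmin j hj⟩, fun h => absurd h.2 (not_le.2 hj'.2)⟩
        have hcard_le := Finset.card_le_card hsub
        rw [Finset.card_sdiff_of_subset (by
          intro j hj
          rw [Finset.mem_filter] at hj ⊢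
          exact ⟨hj.1, hj₀'.2.le.trans hj.2⟩)] at hcard_le
        rw [hcount (lvl j₀), hcount (lvl i)] at hcard_le
        -- window: same coarse level ⇒ rank difference < λ
        have hwin :=
          Summit.ValiantsHypothesis.ValiantsHypothesis.Theorems.DualUnipotentThreeHalvesNegative.FlagCost.sub_lt_of_div_eq_div
            (h := lam) (by omega) (Nat.sub_le_sub_left (hfr_mono hj₀'.2.le) m) hj₀'.1.symm
        have hfle := hfr_le (lvl j₀)
        have hfle' := hfr_le (lvl i)
        have hmono := hfr_mono (s := lvl j₀) (t := lvl i) hj₀'.2.le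
        omega
    -- sum over `i`
    have hS_le : S.card ≤ ∑ i, (Finset.univ.filter (fun j => clvl i = clvl j ∧ lvl j < lvl i)).card := by
      rw [← Finset.card_sigma]
      refine Finset.card_le_card_of_injOn (fun ij => ⟨ij.1, ij.2⟩) ?_ ?_
      · intro ij hij
        rw [Finset.mem_coe, Finset.mem_sigma, Finset.mem_filter]
        exact ⟨Finset.mem_univ _, Finset.mem_univ _, (Finset.mem_filter.1 (Finset.mem_coe.1 hij)).2⟩
      · intro ij _ ij' _ h
        simp only [Sigma.mk.inj_iff, heq_eq_eq] at h
        exact Prod.ext h.1 h.2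
    refine hS_le.trans ?_
    calc ∑ i, (Finset.univ.filter (fun j => clvl i = clvl j ∧ lvl j < lvl i)).card
        ≤ ∑ _i : Fin m, lam := Finset.sum_le_sum fun i _ => hfib i
      _ = lam * m := by rw [Finset.sum_const, Finset.card_univ, Fintype.card_fin, smul_eq_mul, mul_comm]
  -- the budget
  refine ⟨K', (m - 1) / lam, fun x v hv => ?_, ?_⟩
  · obtain ⟨hvK, hvS⟩ := hK'mem v hv
    obtain ⟨h0, h1, h2⟩ := coeff_map_lineSubst N hN x v
    have h1' : (N.map (MvPolynomial.aeval fun c =>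
        (C (x c) + ∑ t : Fin 1, C (v c) * X t : MvPolynomial (Fin 1) ℂ))).map (coeff (Finsupp.single 0 1)) =
        Λ v := by
      rw [h1, hΛ]
    have hres := flagAdaptedUpTo_of_levels b clvl hclvl_lt _ ?_ ?_ h2 n
    · simpa using hres
    · intro i j hij
      rw [h0] at hij
      exact hclvl_mono (key _ _ (hstab _ _ (eval_mem_pencilAdjoin N x) _ (hbF j)) i hij)
    · intro i j hij
      rw [h1'] at hij
      have hfine : lvl j + 1 ≤ lvl i := key _ _ (hclimb _ ⟨Λ v, hΛmem v⟩ (hΛJ v hvK) _ (hbF j)) i hij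
      have hle : clvl j ≤ clvl i := hclvl_mono (by omega)
      rcases hle.lt_or_eq with hlt' | heq
      · exact hlt'
      · exfalso
        have hS : (i, j) ∈ S := Finset.mem_filter.2 ⟨Finset.mem_univ _, heq.symm, (show lvl j < lvl i by omega)⟩
        have := hvS (i, j) hS
        rw [hφ] at this
        exact hij this
  · -- ((m-1)/λ + 1)·n + λ·m ≤ 16mλ + 16n < dim K ≤ dim K' + #S
    have hq : (m - 1) / lam * lam ≤ m := (Nat.div_mul_le_self (m - 1) lam).trans (Nat.sub_le m 1)
    have hqn : (m - 1) / lam * n ≤ m * lam + 2 * m := by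
      calc (m - 1) / lam * n ≤ (m - 1) / lam * (lam * lam + 2 * lam) := Nat.mul_le_mul_left _ hnlam
        _ = ((m - 1) / lam * lam) * lam + 2 * ((m - 1) / lam * lam) := by ring
        _ ≤ m * lam + 2 * m := by nlinarith
    have hS2 := hScard
    have hK2 := hK'dim
    nlinarith

end Main

end Summit.ValiantsHypothesis.ValiantsHypothesis.Theorems.GrenetZeon.RadicalCoarsening

end
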